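import Mathlib.MeasureTheory.Integral.CurveIntegral.Poincare
import Mathlib.Analysis.Calculus.FDeriv.Symmetric
import Mathlib.Analysis.Calculus.Deriv.MeanValue
import Mathlib.Analysis.Calculus.Deriv.Prod
import Literature.Analysis.FluidPDE.GavrilovChart
import HarnessLib

/-!
# Gavrilov's closed form `κ` and its potential `Φ` on the `(F, s)`-plane (Lemma 3, Lemma 4)

Topic `Literature/Analysis/FluidPDE`; support file for the discharge of the named fact
`Literature.Analysis.FluidPDE.gavrilov_compact_steady_euler` (Gavrilov 2019, §1 Theorem):
the middle part of the smooth-category proof of Gavrilov's Lemma 3, and the quantitative form of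
Lemma 4, for an abstract profile record `D : Gavrilov.ProfileData` (`GavrilovChart.lean`).

Following the proof of Lemma 3 (Gavrilov 2019, §2.2): with the inverse chart
`Λ = (X̂, Â) : (F, G) ↦ (x, α)` of `GavrilovChart.lean` and the "ad hoc variable `s`", `G = s²`
(`Gavrilov.sig`), put `x̂(F, s) = X̂(F, s²)`, `â(F, s) = Â(F, s²)` and consider Gavrilov's form
`κ = (∂x/∂s) dF + ((∂α/∂s − F ∂x/∂s)/s) ds`.  Written out, its coefficients are
`P = 2s X̂_G(F, s²)` and `Q = 2(Â_G − F X̂_G)(F, s²)` (`Gavrilov.ProfileData.kP/kQ`), which are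
manifestly smooth (this replaces Gavrilov's remark "it is analytic because `s⁻¹∂/∂s = 2∂/∂G`").
The transported identity (2a) gives the key relation `s κ = dâ − F dx̂`
(`smul_kappa`, Gavrilov's "`s dΦ = dα − F dx`"), from which `dκ = 0` follows by differentiating
and using the symmetry of second derivatives (`kappa_symm`; across `s = 0` by continuity).
Mathlib's Poincaré lemma for closed `1`-forms on convex sets then yields the potential `Φ`,
`dΦ = κ`, `Φ(0,0) = 0` (`Gavrilov.ProfileData.Phi`).  Finally the quantitative Lemma 4:
`Â(F, G) ≥ (F² + G)/16` for `G ≥ 0` near the origin (`ah_lower`), from `∂Â/∂G(0,0) = 1/8`,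
`∂X̂/∂F(0,0) = 1/4` and `∂Â/∂F = F ∂X̂/∂F` on `G = 0` (mean value inequalities).

## References

* A. V. Gavrilov, *A steady Euler flow with compact support*, Geom. Funct. Anal. 29 (2019)
  190–197, §2.2 Lemma 3 (proof: the variable `s`, the form `κ`, `dκ = 0`, the Poincaré lemma,
  `s dΦ = dα − F dx`), Lemma 4. [`Gavrilov2019`]
-/

noncomputable section

open Set Filter Metric Function
open scoped Topology

namespace Literature.Analysis.FluidPDE

namespace Gavrilov

namespace ProfileData

variable {D : ProfileData}

/-! ### The `(F, s)`-plane: `σ(F, s) = (F, s²)`, the functions `x̂, â` and the form `κ` -/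

/-- Gavrilov's "ad hoc variable `s`", `G = s²`: the map `σ(F, s) = (F, s²)`.
[cite: Gavrilov2019, §2.2 Lemma 3 (proof)] -/
def sig (n : ℝ × ℝ) : ℝ × ℝ := (n.1, n.2 ^ 2)

/-- `σ(0, 0) = (0, 0)`. [folklore] -/
@[simp] theorem sig_zero : sig (0, 0) = (0, 0) := by
  simp [sig]

/-- `Dσ = [[1, 0], [0, 2s]]`. [folklore] -/
theorem hasFDerivAt_sig (n : ℝ × ℝ) : HasFDerivAt sig (M 1 0 0 (2 * n.2)) n := by
  have h1 : HasFDerivAt (fun n : ℝ × ℝ => n.1) (L 1 0) n := by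
    simpa using hasFDerivAt_comp_fst (f := fun t => t) (hasDerivAt_id n.1)
  have h2 : HasFDerivAt (fun n : ℝ × ℝ => n.2 ^ 2) (L 0 (2 * n.2)) n := by
    simpa using hasFDerivAt_comp_snd (f := fun t => t ^ 2) (hasDerivAt_pow 2 n.2)
  exact h1.prodMk h2

/-- `σ` is smooth. [folklore] -/
theorem contDiff_sig {n : WithTop ℕ∞} : ContDiff ℝ n sig :=
  contDiff_fst.prodMk (contDiff_snd.pow 2)

variable (D)

/-- The domain `σ⁻¹(target of the chart)` of the `(F, s)`-plane objects. [folklore] -/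
def sigDom : Set (ℝ × ℝ) := sig ⁻¹' D.thetaPH.target

/-- `x̂(F, s) = X̂(F, s²)` ("`x` as a function of `(F, s)`"). [cite: Gavrilov2019, §2.2 Lemma 3 (proof)] -/
def xh (n : ℝ × ℝ) : ℝ := (D.lam (sig n)).1

/-- `â(F, s) = Â(F, s²)` ("`α` as a function of `(F, s)`"). [cite: Gavrilov2019, §2.2 Lemma 3 (proof)] -/
def ah (n : ℝ × ℝ) : ℝ := (D.lam (sig n)).2

/-- The `dF`-coefficient `∂x/∂s = 2s ∂X̂/∂G(F, s²)` of Gavrilov's form `κ`.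
[cite: Gavrilov2019, §2.2 Lemma 3 (proof, definition of `κ`)] -/
def kP (n : ℝ × ℝ) : ℝ := 2 * n.2 * (D.lamZ (sig n)).1

/-- The `ds`-coefficient `(∂α/∂s − F ∂x/∂s)/s = 2(∂Â/∂G − F ∂X̂/∂G)(F, s²)` of Gavrilov's form `κ`
(manifestly smooth: no division by `s`). [cite: Gavrilov2019, §2.2 Lemma 3 (proof, definition of `κ`)] -/
def kQ (n : ℝ × ℝ) : ℝ := 2 * ((D.lamZ (sig n)).2 - n.1 * (D.lamZ (sig n)).1)

/-- Gavrilov's closed `1`-form `κ = (∂x/∂s) dF + ((∂α/∂s − F ∂x/∂s)/s) ds` on the `(F, s)`-plane.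
[cite: Gavrilov2019, §2.2 Lemma 3 (proof, definition of `κ`)] -/
def kappa (n : ℝ × ℝ) : (ℝ × ℝ) →L[ℝ] ℝ := L (D.kP n) (D.kQ n)

variable {D}

/-- The `(F, s)`-domain is open. [folklore] -/
theorem isOpen_sigDom : IsOpen D.sigDom :=
  isOpen_thetaPH_target.preimage (contDiff_sig (n := 0)).continuous

/-- `(0, 0)` lies in the `(F, s)`-domain. [folklore] -/
theorem zero_mem_sigDom : ((0 : ℝ), (0 : ℝ)) ∈ D.sigDom := by
  simp [sigDom, zero_mem_thetaPH_target]

/-- Membership in the `(F, s)`-domain. [folklore] -/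
theorem sig_mem_of_mem_sigDom {n : ℝ × ℝ} (hn : n ∈ D.sigDom) : sig n ∈ D.thetaPH.target := hn

/-- `x̂(0, 0) = 1`. [folklore] -/
@[simp] theorem xh_zero : D.xh (0, 0) = 1 := by
  simp [xh]

/-- `â(0, 0) = 0`. [folklore] -/
@[simp] theorem ah_zero : D.ah (0, 0) = 0 := by
  simp [ah]

/-- `P(0, 0) = 0`. [folklore] -/
@[simp] theorem kP_zero : D.kP (0, 0) = 0 := by
  simp [kP]

/-- `Q(0, 0) = 1/4` (Gavrilov: "`Φ(F, s) = (1/4 + O(F))s + O(s³)`"). [cite: Gavrilov2019, §2.2 Lemma 3 (proof)] -/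
@[simp] theorem kQ_zero : D.kQ (0, 0) = 1 / 4 := by
  simp [kQ]
  norm_num

/-- `D(Λ ∘ σ) = DΛ(σ n) ∘ Dσ(n)`. [folklore] -/
theorem hasFDerivAt_lam_sig {n : ℝ × ℝ} (hn : n ∈ D.sigDom) :
    HasFDerivAt (fun n => D.lam (sig n)) ((fderiv ℝ D.lam (sig n)).comp (M 1 0 0 (2 * n.2))) n :=
  ((contDiffAt_lam hn).differentiableAt (by simp)).hasFDerivAt.comp n (hasFDerivAt_sig n)

/-- `(0, 2s) = 2s • (0, 1)` in `ℝ × ℝ`. [folklore] -/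
theorem zero_two_mul_eq_smul (s : ℝ) : ((0 : ℝ), 2 * s) = (2 * s) • ((0 : ℝ), (1 : ℝ)) := by
  ext <;> simp

/-- `Dx̂ = X̂_F(F, s²) dF + 2s X̂_G(F, s²) ds`, i.e. `∂x̂/∂s = P`. [cite: Gavrilov2019, §2.2 Lemma 3 (proof)] -/
theorem hasFDerivAt_xh {n : ℝ × ℝ} (hn : n ∈ D.sigDom) :
    HasFDerivAt D.xh (L (D.lamW (sig n)).1 (D.kP n)) n := by
  have h := hasFDerivAt_fst.comp n (hasFDerivAt_lam_sig hn)
  refine h.congr_fderiv ?_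
  rw [eq_L ((ContinuousLinearMap.fst ℝ ℝ ℝ).comp _)]
  congr 1
  · simp [lamW, sig]
  · simp only [ContinuousLinearMap.coe_comp, comp_apply, M_apply, mul_zero, mul_one,
      zero_add, ContinuousLinearMap.coe_fst', kP, lamZ]
    rw [zero_two_mul_eq_smul, map_smul]
    simp [sig]

/-- `Dâ = Â_F(F, s²) dF + 2s Â_G(F, s²) ds`. [cite: Gavrilov2019, §2.2 Lemma 3 (proof)] -/
theorem hasFDerivAt_ah {n : ℝ × ℝ} (hn : n ∈ D.sigDom) :
    HasFDerivAt D.ah (L (D.lamW (sig n)).2 (2 * n.2 * (D.lamZ (sig n)).2)) n := by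
  have h := hasFDerivAt_snd.comp n (hasFDerivAt_lam_sig hn)
  refine h.congr_fderiv ?_
  rw [eq_L ((ContinuousLinearMap.snd ℝ ℝ ℝ).comp _)]
  congr 1
  · simp [lamW, sig]
  · simp only [ContinuousLinearMap.coe_comp, comp_apply, M_apply, mul_zero, mul_one,
      zero_add, ContinuousLinearMap.coe_snd', lamZ]
    rw [zero_two_mul_eq_smul, map_smul]
    simp [sig]

/-- **The key relation** `s κ = dâ − F dx̂` (Gavrilov: "`s dΦ = dα − F dx`"), from the transported
identity (2a). [cite: Gavrilov2019, §2.2 Lemma 3 (proof: "`s dΦ = dα − F dx`")] -/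
theorem smul_kappa {n : ℝ × ℝ} (hn : n ∈ D.sigDom) :
    n.2 • D.kappa n = fderiv ℝ D.ah n - n.1 • fderiv ℝ D.xh n := by
  rw [(hasFDerivAt_ah hn).fderiv, (hasFDerivAt_xh hn).fderiv, kappa]
  have ht := chart_transport (sig_mem_of_mem_sigDom hn)
  simp only [sig] at ht
  apply ContinuousLinearMap.ext
  intro v
  simp only [_root_.FunLike.coe_smul, Pi.smul_apply, L_apply, smul_eq_mul, _root_.FunLike.coe_sub,
    Pi.sub_apply, kP, kQ, sig]
  linear_combination (-v.1) * ht

/-! ### Smoothness on the `(F, s)`-domain -/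

/-- `x̂` is smooth on the `(F, s)`-domain. [folklore] -/
theorem contDiffOn_xh : ContDiffOn ℝ (⊤ : ℕ∞) D.xh D.sigDom :=
  (contDiffOn_lam.comp contDiff_sig.contDiffOn fun _ hn => hn).fst

/-- `â` is smooth on the `(F, s)`-domain. [folklore] -/
theorem contDiffOn_ah : ContDiffOn ℝ (⊤ : ℕ∞) D.ah D.sigDom :=
  (contDiffOn_lam.comp contDiff_sig.contDiffOn fun _ hn => hn).snd

/-- `∂Λ/∂G ∘ σ` is smooth on the `(F, s)`-domain. [folklore] -/
theorem contDiffOn_lamZ_sig : ContDiffOn ℝ (⊤ : ℕ∞) (fun n => D.lamZ (sig n)) D.sigDom :=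
  contDiffOn_lamZ.comp contDiff_sig.contDiffOn fun _ hn => hn

/-- `∂Λ/∂F ∘ σ` is smooth on the `(F, s)`-domain. [folklore] -/
theorem contDiffOn_lamW_sig : ContDiffOn ℝ (⊤ : ℕ∞) (fun n => D.lamW (sig n)) D.sigDom :=
  contDiffOn_lamW.comp contDiff_sig.contDiffOn fun _ hn => hn

/-- `P` is smooth on the `(F, s)`-domain. [folklore] -/
theorem contDiffOn_kP : ContDiffOn ℝ (⊤ : ℕ∞) D.kP D.sigDom :=
  (contDiffOn_const.mul contDiffOn_snd).mul contDiffOn_lamZ_sig.fst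

/-- `Q` is smooth on the `(F, s)`-domain. [folklore] -/
theorem contDiffOn_kQ : ContDiffOn ℝ (⊤ : ℕ∞) D.kQ D.sigDom :=
  contDiffOn_const.mul (contDiffOn_lamZ_sig.snd.sub (contDiffOn_fst.mul contDiffOn_lamZ_sig.fst))

/-- `κ` is smooth on the `(F, s)`-domain. [folklore] -/
theorem contDiffOn_kappa : ContDiffOn ℝ (⊤ : ℕ∞) D.kappa D.sigDom := by
  have h : ContDiffOn ℝ (⊤ : ℕ∞) (fun n => D.kP n • ContinuousLinearMap.fst ℝ ℝ ℝ +
      D.kQ n • ContinuousLinearMap.snd ℝ ℝ ℝ) D.sigDom :=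
    (contDiffOn_kP.smul contDiffOn_const).add (contDiffOn_kQ.smul contDiffOn_const)
  exact h

/-! ### `κ` is closed -/

/-- `dκ` is symmetric off the axis `s = 0`: differentiate `s κ = dâ − F dx̂` and use the symmetry
of the second derivatives of `â` and `x̂`. [cite: Gavrilov2019, §2.2 Lemma 3 (proof: "`dκ = 0`")] -/
theorem kappa_symm_of_ne {a : ℝ × ℝ} (ha : a ∈ D.sigDom) (hs : a.2 ≠ 0) (u v : ℝ × ℝ) :
    fderiv ℝ D.kappa a u v = fderiv ℝ D.kappa a v u := by
  have hopen : D.sigDom ∈ 𝓝 a := isOpen_sigDom.mem_nhds ha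
  -- differentiability facts
  have hκ : DifferentiableAt ℝ D.kappa a :=
    (contDiffOn_kappa.contDiffAt hopen).differentiableAt (by simp)
  have hah2 : ContDiffAt ℝ (⊤ : ℕ∞) D.ah a := contDiffOn_ah.contDiffAt hopen
  have hxh2 : ContDiffAt ℝ (⊤ : ℕ∞) D.xh a := contDiffOn_xh.contDiffAt hopen
  have hdah : DifferentiableAt ℝ (fderiv ℝ D.ah) a :=
    (hah2.fderiv_right (m := 1) (WithTop.coe_le_coe.2 le_top)).differentiableAt (by simp)
  have hdxh : DifferentiableAt ℝ (fderiv ℝ D.xh) a :=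
    (hxh2.fderiv_right (m := 1) (WithTop.coe_le_coe.2 le_top)).differentiableAt (by simp)
  have h2 : minSmoothness ℝ 2 ≤ ((⊤ : ℕ∞) : WithTop ℕ∞) := by
    rw [minSmoothness_of_isRCLikeNormedField]
    exact WithTop.coe_le_coe.2 le_top
  have hsym_ah : IsSymmSndFDerivAt ℝ D.ah a := hah2.isSymmSndFDerivAt h2
  have hsym_xh : IsSymmSndFDerivAt ℝ D.xh a := hxh2.isSymmSndFDerivAt h2
  -- the two sides of `s κ = dâ − F dx̂` and their derivatives
  have e1 : (fun n : ℝ × ℝ => n.2 • D.kappa n) =ᶠ[𝓝 a]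
      (fun n => fderiv ℝ D.ah n - n.1 • fderiv ℝ D.xh n) :=
    eventually_of_mem hopen fun n hn => smul_kappa hn
  have hL : HasFDerivAt (fun n : ℝ × ℝ => n.2 • D.kappa n)
      (a.2 • fderiv ℝ D.kappa a + (ContinuousLinearMap.snd ℝ ℝ ℝ).smulRight (D.kappa a)) a :=
    hasFDerivAt_snd.smul hκ.hasFDerivAt
  have hR : HasFDerivAt (fun n : ℝ × ℝ => fderiv ℝ D.ah n - n.1 • fderiv ℝ D.xh n)
      (fderiv ℝ (fderiv ℝ D.ah) a - (a.1 • fderiv ℝ (fderiv ℝ D.xh) a +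
        (ContinuousLinearMap.fst ℝ ℝ ℝ).smulRight (fderiv ℝ D.xh a))) a :=
    hdah.hasFDerivAt.sub (hasFDerivAt_fst.smul hdxh.hasFDerivAt)
  have hE := hL.unique (hR.congr_of_eventuallyEq e1)
  -- evaluate at `(u, v)` and `(v, u)`
  have hEuv := congrArg (fun T : (ℝ × ℝ) →L[ℝ] (ℝ × ℝ) →L[ℝ] ℝ => T u v) hE
  have hEvu := congrArg (fun T : (ℝ × ℝ) →L[ℝ] (ℝ × ℝ) →L[ℝ] ℝ => T v u) hE
  simp only [_root_.add_apply, _root_.FunLike.coe_smul, Pi.smul_apply,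
    ContinuousLinearMap.smulRight_apply, ContinuousLinearMap.coe_snd', _root_.sub_apply,
    ContinuousLinearMap.coe_fst', smul_eq_mul] at hEuv hEvu
  rw [hsym_ah u v, hsym_xh u v] at hEuv
  have hκa : D.kappa a = L (D.kP a) (D.kQ a) := rfl
  have hxa : fderiv ℝ D.xh a = L (D.lamW (sig a)).1 (D.kP a) := (hasFDerivAt_xh ha).fderiv
  rw [hκa, hxa] at hEuv hEvu
  simp only [L_apply] at hEuv hEvu
  apply mul_left_cancel₀ hs
  linear_combination hEuv - hEvu

/-- The complement of the axis `s = 0` is dense in the `(F, s)`-plane. [folklore] -/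
theorem dense_snd_ne_zero : Dense {n : ℝ × ℝ | n.2 ≠ 0} :=
  (dense_compl_singleton (0 : ℝ)).preimage isOpenMap_snd

/-- **`κ` is closed** (`dκ = 0`): `dκ` is symmetric on the whole `(F, s)`-domain (by continuity
across `s = 0`). [cite: Gavrilov2019, §2.2 Lemma 3 (proof: "`dκ = 0`")] -/
theorem kappa_symm {a : ℝ × ℝ} (ha : a ∈ D.sigDom) (u v : ℝ × ℝ) :
    fderiv ℝ D.kappa a u v = fderiv ℝ D.kappa a v u := by
  -- the continuous function `g n = dκ(n)(u, v) − dκ(n)(v, u)` vanishes on the dense set `s ≠ 0`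
  set g : ℝ × ℝ → ℝ := fun n => fderiv ℝ D.kappa n u v - fderiv ℝ D.kappa n v u with hg
  have hcont : ContinuousOn (fderiv ℝ D.kappa) D.sigDom :=
    contDiffOn_kappa.continuousOn_fderiv_of_isOpen isOpen_sigDom (by simp)
  have hgc : ContinuousOn g D.sigDom := by
    have h1 : ContinuousOn (fun n => fderiv ℝ D.kappa n u v) D.sigDom :=
      ((ContinuousLinearMap.apply ℝ ℝ v).continuous.comp_continuousOn
        ((ContinuousLinearMap.apply ℝ ((ℝ × ℝ) →L[ℝ] ℝ) u).continuous.comp_continuousOn hcont))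
    have h2 : ContinuousOn (fun n => fderiv ℝ D.kappa n v u) D.sigDom :=
      ((ContinuousLinearMap.apply ℝ ℝ u).continuous.comp_continuousOn
        ((ContinuousLinearMap.apply ℝ ((ℝ × ℝ) →L[ℝ] ℝ) v).continuous.comp_continuousOn hcont))
    exact h1.sub h2
  have hzero : ∀ n ∈ D.sigDom ∩ {n : ℝ × ℝ | n.2 ≠ 0}, g n = 0 := fun n hn => by
    simp only [hg, kappa_symm_of_ne hn.1 hn.2 u v, sub_self]
  have hcl : a ∈ closure (D.sigDom ∩ {n : ℝ × ℝ | n.2 ≠ 0}) :=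
    dense_snd_ne_zero.open_subset_closure_inter isOpen_sigDom ha
  have hga : g a = 0 := by
    have ht : Tendsto g (𝓝[D.sigDom ∩ {n : ℝ × ℝ | n.2 ≠ 0}] a) (𝓝 (g a)) :=
      ((hgc a ha).mono inter_subset_left).tendsto
    have ht0 : Tendsto g (𝓝[D.sigDom ∩ {n : ℝ × ℝ | n.2 ≠ 0}] a) (𝓝 0) :=
      tendsto_const_nhds.congr' (eventually_nhdsWithin_of_forall fun n hn => (hzero n hn).symm)
    haveI : (𝓝[D.sigDom ∩ {n : ℝ × ℝ | n.2 ≠ 0}] a).NeBot := mem_closure_iff_nhdsWithin_neBot.1 hcl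
    exact tendsto_nhds_unique ht ht0
  simpa [hg, sub_eq_zero] using hga

/-! ### The potential `Φ` (Poincaré lemma) -/

variable (D)

/-- A ball around the origin inside the `(F, s)`-domain exists. [folklore] -/
theorem exists_ball_subset_sigDom : ∃ r : ℝ, 0 < r ∧ ball ((0 : ℝ), (0 : ℝ)) r ⊆ D.sigDom :=
  Metric.isOpen_iff.1 isOpen_sigDom _ zero_mem_sigDom

/-- The radius of a ball around the origin inside the `(F, s)`-domain. [folklore] -/
def rad0 : ℝ := Classical.choose D.exists_ball_subset_sigDom

/-- The radius is positive. [folklore] -/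
theorem rad0_pos : 0 < D.rad0 := (Classical.choose_spec D.exists_ball_subset_sigDom).1

/-- The ball lies in the `(F, s)`-domain. [folklore] -/
theorem ball_rad0_subset : ball ((0 : ℝ), (0 : ℝ)) D.rad0 ⊆ D.sigDom :=
  (Classical.choose_spec D.exists_ball_subset_sigDom).2

/-- **Poincaré lemma for `κ`**: on the ball, `κ` has a primitive. [cite: Gavrilov2019, §2.2 Lemma 3 (proof: "By the Poincaré lemma, there is a unique analytic function `Φ` …")] -/
theorem exists_primitive : ∃ f : ℝ × ℝ → ℝ, ∀ a ∈ ball ((0 : ℝ), (0 : ℝ)) D.rad0, HasFDerivAt f (D.kappa a) a :=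
  (convex_ball _ _).exists_forall_hasFDerivAt_of_fderiv_symmetric isOpen_ball
    ((contDiffOn_kappa.mono D.ball_rad0_subset).differentiableOn (by simp))
    fun a ha u v => kappa_symm (D.ball_rad0_subset ha) u v

/-- **Gavrilov's potential `Φ`**: `dΦ = κ`, `Φ(0, 0) = 0` (it is `y` as a function of `(F, s)`).
[cite: Gavrilov2019, §2.2 Lemma 3 (proof: the function `Φ(F, s)`)] -/
def Phi (n : ℝ × ℝ) : ℝ :=
  Classical.choose D.exists_primitive n - Classical.choose D.exists_primitive (0, 0)

variable {D}

/-- `dΦ = κ` on the ball. [cite: Gavrilov2019, §2.2 Lemma 3 (proof)] -/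
theorem hasFDerivAt_Phi {a : ℝ × ℝ} (ha : a ∈ ball ((0 : ℝ), (0 : ℝ)) D.rad0) :
    HasFDerivAt D.Phi (D.kappa a) a :=
  (Classical.choose_spec D.exists_primitive a ha).sub_const _

/-- `Φ(0, 0) = 0`. [cite: Gavrilov2019, §2.2 Lemma 3 (proof)] -/
@[simp] theorem Phi_zero : D.Phi (0, 0) = 0 := sub_self _

/-- `Φ` is smooth on the ball. [folklore] -/
theorem contDiffOn_Phi : ContDiffOn ℝ (⊤ : ℕ∞) D.Phi (ball ((0 : ℝ), (0 : ℝ)) D.rad0) := by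
  rw [show ((⊤ : ℕ∞) : WithTop ℕ∞) = (⊤ : ℕ∞) from rfl, contDiffOn_infty_iff_fderiv_of_isOpen isOpen_ball]
  refine ⟨fun a ha => (hasFDerivAt_Phi ha).differentiableAt.differentiableWithinAt, ?_⟩
  exact (contDiffOn_kappa.mono D.ball_rad0_subset).congr fun a ha => (hasFDerivAt_Phi ha).fderiv

/-! ### Lower bound for `Â` near the origin (Lemma 4, quantitative) -/

/-- Curves `G ↦ Λ(F, G)`: derivative `∂Λ/∂G`. [folklore] -/
theorem hasDerivAt_lam_curveG {F G : ℝ} (h : (F, G) ∈ D.thetaPH.target) :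
    HasDerivAt (fun t : ℝ => (D.lam (F, t)).2) (D.lamZ (F, G)).2 G := by
  have hc : HasDerivAt (fun t : ℝ => ((F, t) : ℝ × ℝ)) ((0 : ℝ), (1 : ℝ)) G := by
    have := (hasDerivAt_const G F).prodMk (hasDerivAt_id G)
    simpa using this
  have hl : HasFDerivAt D.lam (fderiv ℝ D.lam (F, G)) (F, G) :=
    ((contDiffAt_lam h).differentiableAt (by simp)).hasFDerivAt
  have h2 := (hasFDerivAt_snd (𝕜 := ℝ) (E := ℝ) (F := ℝ)).comp (F, G) hl
  exact h2.comp_hasDerivAt G hc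

/-- Curves `F ↦ Λ(F, 0)`: derivative `∂Λ/∂F`. [folklore] -/
theorem hasDerivAt_lam_curveF {F : ℝ} (h : (F, (0 : ℝ)) ∈ D.thetaPH.target) :
    HasDerivAt (fun t : ℝ => (D.lam (t, 0)).2) (D.lamW (F, 0)).2 F := by
  have hc : HasDerivAt (fun t : ℝ => ((t, 0) : ℝ × ℝ)) ((1 : ℝ), (0 : ℝ)) F := by
    have := (hasDerivAt_id F).prodMk (hasDerivAt_const F (0 : ℝ))
    simpa using this
  have hl : HasFDerivAt D.lam (fderiv ℝ D.lam (F, 0)) (F, 0) :=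
    ((contDiffAt_lam h).differentiableAt (by simp)).hasFDerivAt
  have h2 := (hasFDerivAt_snd (𝕜 := ℝ) (E := ℝ) (F := ℝ)).comp (F, 0) hl
  exact h2.comp_hasDerivAt F hc

variable (D)

/-- A ball around the origin of the `(F, G)`-plane, inside the target of the chart, on which
`∂Â/∂G ≥ 1/16` and `∂X̂/∂F ≥ 1/8` (half their values at the origin). [folklore] -/
theorem exists_good_ball : ∃ r : ℝ, 0 < r ∧ ball ((0 : ℝ), (0 : ℝ)) r ⊆ D.thetaPH.target ∧
    ∀ m ∈ ball ((0 : ℝ), (0 : ℝ)) r, 1 / 16 ≤ (D.lamZ m).2 ∧ 1 / 8 ≤ (D.lamW m).1 := by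
  have hT : D.thetaPH.target ∈ 𝓝 ((0 : ℝ), (0 : ℝ)) :=
    isOpen_thetaPH_target.mem_nhds zero_mem_thetaPH_target
  have hcZ : ContinuousAt (fun m => (D.lamZ m).2) (0, 0) :=
    ((contDiffOn_lamZ.continuousOn.continuousAt hT).snd)
  have hcW : ContinuousAt (fun m => (D.lamW m).1) (0, 0) :=
    ((contDiffOn_lamW.continuousOn.continuousAt hT).fst)
  have hZ : ∀ᶠ m in 𝓝 ((0 : ℝ), (0 : ℝ)), 1 / 16 ≤ (D.lamZ m).2 := by
    have : (1 : ℝ) / 16 < (D.lamZ (0, 0)).2 := by simp; norm_num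
    exact (hcZ.eventually (lt_mem_nhds this)).mono fun m hm => hm.le
  have hW : ∀ᶠ m in 𝓝 ((0 : ℝ), (0 : ℝ)), 1 / 8 ≤ (D.lamW m).1 := by
    have : (1 : ℝ) / 8 < (D.lamW (0, 0)).1 := by simp; norm_num
    exact (hcW.eventually (lt_mem_nhds this)).mono fun m hm => hm.le
  obtain ⟨r, hr, hsub⟩ := Metric.eventually_nhds_iff_ball.1 (Filter.inter_mem hT (hZ.and hW))
  exact ⟨r, hr, fun m hm => (hsub m hm).1, fun m hm => (hsub m hm).2⟩

/-- The radius of the good ball. [folklore] -/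
def rad1 : ℝ := Classical.choose D.exists_good_ball

/-- The good radius is positive. [folklore] -/
theorem rad1_pos : 0 < D.rad1 := (Classical.choose_spec D.exists_good_ball).1

/-- The good ball lies in the target of the chart. [folklore] -/
theorem ball_rad1_subset : ball ((0 : ℝ), (0 : ℝ)) D.rad1 ⊆ D.thetaPH.target :=
  (Classical.choose_spec D.exists_good_ball).2.1

variable {D}

/-- `∂Â/∂G ≥ 1/16` on the good ball. [folklore] -/
theorem lamZ_snd_ge {m : ℝ × ℝ} (hm : m ∈ ball ((0 : ℝ), (0 : ℝ)) D.rad1) : 1 / 16 ≤ (D.lamZ m).2 :=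
  ((Classical.choose_spec D.exists_good_ball).2.2 m hm).1

/-- `∂X̂/∂F ≥ 1/8` on the good ball. [folklore] -/
theorem lamW_fst_ge {m : ℝ × ℝ} (hm : m ∈ ball ((0 : ℝ), (0 : ℝ)) D.rad1) : 1 / 8 ≤ (D.lamW m).1 :=
  ((Classical.choose_spec D.exists_good_ball).2.2 m hm).2

/-- Membership in the (sup-norm) ball of `ℝ × ℝ`. [folklore] -/
theorem mem_ball_zero_prod {m : ℝ × ℝ} {r : ℝ} :
    m ∈ ball ((0 : ℝ), (0 : ℝ)) r ↔ |m.1| < r ∧ |m.2| < r := by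
  rw [show ((0 : ℝ), (0 : ℝ)) = (0 : ℝ × ℝ) from rfl, mem_ball_zero_iff, Prod.norm_def,
    max_lt_iff, Real.norm_eq_abs, Real.norm_eq_abs]

/-- **Lemma 4, quantitative, in the variable `G`**: `Â(F, G) ≥ Â(F, 0) + G/16` for `G ≥ 0` in the
good ball. [cite: Gavrilov2019, §2.2 Lemma 4] -/
theorem ah_G_lower {m : ℝ × ℝ} (hm : m ∈ ball ((0 : ℝ), (0 : ℝ)) D.rad1) (hG : 0 ≤ m.2) :
    (D.lam (m.1, 0)).2 + m.2 / 16 ≤ (D.lam m).2 := by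
  rw [mem_ball_zero_prod] at hm
  set I : Set ℝ := Ioo (-D.rad1) D.rad1 with hI
  have hmem : ∀ t ∈ I, ((m.1, t) : ℝ × ℝ) ∈ ball ((0 : ℝ), (0 : ℝ)) D.rad1 := fun t ht => by
    rw [mem_ball_zero_prod]
    exact ⟨hm.1, abs_lt.2 ht⟩
  have hderiv : ∀ t ∈ I, HasDerivAt (fun t : ℝ => (D.lam (m.1, t)).2) (D.lamZ (m.1, t)).2 t :=
    fun t ht => hasDerivAt_lam_curveG (D.ball_rad1_subset (hmem t ht))
  have hcont : ContinuousOn (fun t : ℝ => (D.lam (m.1, t)).2) I :=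
    fun t ht => (hderiv t ht).continuousAt.continuousWithinAt
  have hdiff : DifferentiableOn ℝ (fun t : ℝ => (D.lam (m.1, t)).2) (interior I) := by
    rw [hI, interior_Ioo]
    exact fun t ht => (hderiv t ht).differentiableAt.differentiableWithinAt
  have hge : ∀ t ∈ interior I, (1 : ℝ) / 16 ≤ deriv (fun t : ℝ => (D.lam (m.1, t)).2) t := by
    rw [hI, interior_Ioo]
    intro t ht
    rw [(hderiv t ht).deriv]
    exact lamZ_snd_ge (hmem t ht)
  have h0 : (0 : ℝ) ∈ I := ⟨by linarith [D.rad1_pos], D.rad1_pos⟩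
  have h2 : m.2 ∈ I := abs_lt.1 hm.2
  have key := (convex_Ioo (-D.rad1) D.rad1).mul_sub_le_image_sub_of_le_deriv hcont hdiff hge
    0 h0 m.2 h2 hG
  simp only [sub_zero] at key
  have : (m.1, m.2) = m := rfl
  rw [this] at key
  linarith

/-- **Lemma 4, quantitative, in the variable `F`**: `Â(F, 0) ≥ F²/16` in the good ball.
[cite: Gavrilov2019, §2.2 Lemma 4] -/
theorem ah_F_lower {F : ℝ} (hF : |F| < D.rad1) : F ^ 2 / 16 ≤ (D.lam (F, 0)).2 := by
  set h : ℝ → ℝ := fun t => (D.lam (t, 0)).2 - t ^ 2 / 16 with hh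
  have hmem : ∀ t : ℝ, |t| < D.rad1 → ((t, (0 : ℝ)) : ℝ × ℝ) ∈ ball ((0 : ℝ), (0 : ℝ)) D.rad1 :=
    fun t ht => by
      rw [mem_ball_zero_prod]
      exact ⟨ht, by simpa using D.rad1_pos⟩
  have hderiv : ∀ t : ℝ, |t| < D.rad1 →
      HasDerivAt h (t * ((D.lamW (t, 0)).1 - 1 / 8)) t := fun t ht => by
    have h1 := hasDerivAt_lam_curveF (D.ball_rad1_subset (hmem t ht))
    have h2 : HasDerivAt (fun t : ℝ => t ^ 2 / 16) (t / 8) t :=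
      ((hasDerivAt_pow 2 t).div_const 16).congr_deriv (by norm_num; ring)
    have h3 := h1.sub h2
    have ht' := chart_transport (D.ball_rad1_subset (hmem t ht))
    simp only [mul_zero, zero_mul, add_zero] at ht'
    refine h3.congr_deriv ?_
    rw [ht']
    ring
  have hcont : ∀ t : ℝ, |t| < D.rad1 → ContinuousAt h t := fun t ht => (hderiv t ht).continuousAt
  have h0 : h 0 = 0 := by simp [hh]
  suffices hmain : 0 ≤ h F by
    simp only [hh] at hmain
    linarith
  rcases le_or_gt 0 F with hF0 | hF0
  · -- monotone on `[0, rad1)`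
    have hmono : MonotoneOn h (Ico 0 D.rad1) := by
      refine monotoneOn_of_deriv_nonneg (convex_Ico 0 D.rad1) (fun t ht => ?_) ?_ ?_
      · exact (hcont t (abs_lt.2 ⟨by linarith [ht.1, D.rad1_pos], ht.2⟩)).continuousWithinAt
      · rw [interior_Ico]
        exact fun t ht => (hderiv t (abs_lt.2 ⟨by linarith [ht.1, D.rad1_pos], ht.2⟩)).differentiableAt
          |>.differentiableWithinAt
      · rw [interior_Ico]
        intro t ht
        have ht' : |t| < D.rad1 := abs_lt.2 ⟨by linarith [ht.1, D.rad1_pos], ht.2⟩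
        rw [(hderiv t ht').deriv]
        exact mul_nonneg ht.1.le (by linarith [lamW_fst_ge (hmem t ht')])
    have := hmono ⟨le_rfl, D.rad1_pos⟩ ⟨hF0, (abs_lt.1 hF).2⟩ hF0
    rwa [h0] at this
  · -- antitone on `(-rad1, 0]`
    have hanti : AntitoneOn h (Ioc (-D.rad1) 0) := by
      refine antitoneOn_of_deriv_nonpos (convex_Ioc (-D.rad1) 0) (fun t ht => ?_) ?_ ?_
      · exact (hcont t (abs_lt.2 ⟨ht.1, by linarith [ht.2, D.rad1_pos]⟩)).continuousWithinAt
      · rw [interior_Ioc]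
        exact fun t ht => (hderiv t (abs_lt.2 ⟨ht.1, by linarith [ht.2, D.rad1_pos]⟩)).differentiableAt
          |>.differentiableWithinAt
      · rw [interior_Ioc]
        intro t ht
        have ht' : |t| < D.rad1 := abs_lt.2 ⟨ht.1, by linarith [ht.2, D.rad1_pos]⟩
        rw [(hderiv t ht').deriv]
        exact mul_nonpos_of_nonpos_of_nonneg ht.2.le (by linarith [lamW_fst_ge (hmem t ht')])
    have := hanti ⟨(abs_lt.1 hF).1, hF0.le⟩ ⟨by linarith [D.rad1_pos], le_rfl⟩ hF0.le
    rwa [h0] at this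

/-- **Lemma 4, quantitative**: `Â(F, G) ≥ (F² + G)/16` for `G ≥ 0` in the good ball — the strict
minimum of `α` at the circle. [cite: Gavrilov2019, §2.2 Lemma 4] -/
theorem ah_lower {m : ℝ × ℝ} (hm : m ∈ ball ((0 : ℝ), (0 : ℝ)) D.rad1) (hG : 0 ≤ m.2) :
    m.1 ^ 2 / 16 + m.2 / 16 ≤ (D.lam m).2 := by
  have h1 := ah_G_lower hm hG
  have h2 := ah_F_lower (D := D) ((mem_ball_zero_prod.1 hm).1)
  linarith

end ProfileData

end Gavrilov

end Literature.Analysis.FluidPDE
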